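import Summits.QuantumFields.YangMills.Theorems.BalabanUVNodesN15TwoSpacingGluingNeumannDefectClosed
import Summits.QuantumFields.YangMills.Theorems.BalabanUVNodesN15TwoSpacingGluingNeumannKnitDefectRecord
import HarnessLib

/-!
# THE GLUING STEP AT TWO LATTICE SPACINGS, XLII: THE TWO-GRID η-DEFECT OF THE TORUS PROPAGATOR PAIRS `(Δ′_a⁻¹, Δ_a⁻¹)` AT `U ≡ 1` ASSEMBLED FROM CUBE DATA, NO DISPLAYED ROW — ON THE
# DOUBLED TORUS (dag-n15-c FILE 80 §1 + FILE 70 (iii)) AND ON THE TORUS OF RECORD (dag-n15-c FILE 82 + FILE 73 (iii)), BOTH MEMBERS OF EACH PAIR IDENTIFIED (dag-n15-a g22, PROGRAMME R,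
# file R-C; N15 = NE2, s1 «background-layer OPERATOR ingredient»)

Cell `pub-ymgap`, seat `pub-ymgap-dag-n15-a` (R134 (a); HUMAN RULING D-0062), generation 22.  `bears_on: R4∕N15 · K3⁷ SpineGivenEndpointR13SepCoPH (stmt-QuantumFields-20544)`.
Filed `--kind proof --supports stmt-QuantumFields-20544 --as helper` — COUNT-NEUTRAL.  Theorems only (0 `def`, 0 `sorry`).  Imports BY NAME dag-n15-c FILE 80 (`hasMaj_idef_knitGlued_closed` = FILE 78
with its displayed row inhabited by dag-n15-a N-IIm; through it FILE 70 `knitGlued` ∕ `knitGlued_spec`) and dag-n15-c FILE 82 (`hasMaj_idef_knitGluedR` = FILE 63 on FILE 73's cover; through it FILE 73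
`knitGluedR` ∕ `knitGluedR_spec`, FILE 81, dag-n15-a PROGRAMME P); nothing in the tree is modified.

WHAT.  §1 the doubled torus `M = MP (paramsOf d L (m+1) k hL)` (`M_ν = 2L·L^m`); §2 the torus of record `M = MP (paramsOf d L m_T K hL)` (`M_ν = 2L^{m_T}`, FREE), cover cubes of side `L^{s+1}`;
coarse spacing `L^{−k}`, fine spacing `L^{−(k+r)}`, King's pairing `P`:
* ★ `knitGlued_eq_gOp_fine` ∕ ★ `knitGluedR_eq_gOp_fine` — FILE 70 (iii) ∕ FILE 73 (iii) AT BOTH MEMBERS OF THE PAIR: under the guard (`L^m ≥ w₀` ∕ `L^s ≥ w₀`) the glued operator of the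
  cover IS the torus propagator at the coarse spacing AND at the fine spacing `L^r·L^k` of the same torus.  The torus `MP (paramsOf d L · k hL)` does not depend on the spacing exponent `k`
  (definitionally), so the spec's clause at index `r + k` transports along `L^{r+k} = L^r·L^k` by `subst` on a generic spacing;
* ★★★ **`hasMaj_idef_gOp_pair_of_cubes`** (doubled torus) ∕ ★★★ **`hasMaj_idef_gOp_pair_record`** (torus of record, constants FREE OF THE VOLUME) — `∃ δ w₀ D > 0`:
  `𝔇(Δ′_a⁻¹, Δ_a⁻¹) ≤ D·(L^k)^{−1∕16}·e^{−δ|y−y′|_T}` for `k ≥ 1`, `4 ≤ L^k` and the guard — FILE 80 `hasMaj_idef_knitGlued_closed` ∕ FILE 82 `hasMaj_idef_knitGluedR` rewritten at both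
  members.  These are the PROPAGATOR-LEVEL, row-free statements FILE 50's entry-0 socket reads, on either torus.

HONEST FRAMING ∕ LIMITS.  Count-neutral bookkeeping (one `obtain` and two rewrites per torus) over LANDED rows at `U ≡ 1`.  On the doubled torus (cube = half torus) §1 is, as an ESTIMATE
of `𝔇(G′, G)`, circular through the torus letters feeding PROGRAMME N (parts 43–45 give it directly) — what is certified is the COMPOSITION of [B6] §2's parametrix machine ((2.36)–(2.37)
p.229, (2.91)–(2.93) p.239, (2.133)–(2.136) p.247) with [B9] Thm 3.14's difference template (pp.426–427), every hypothesis inhabited, guards and rate live, NO row displayed; on the torus of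
record §2's letter comes from CUBE data of fixed size plus the torus's own `∂Π∂*` letter (part 41), its two-grid defect and the uniqueness clause FILE 73 (iii), volume-free.  Nothing of
[B5]∕[B6] (2.38)–(2.40)∕[B9] asserted.  NE2⁺ NOT PRINTED, NOT proved; N15 NOT discharged; counts of record UNMOVED (typed 28∕28 · discharged 5∕27); one finite 𝕋⁴ at fixed ε per index —
NOT infinite volume, NOT OS on ℝ⁴, NOT a mass gap, NOT Clay; R4 closes the conditional finite-𝕋⁴ rung `BalabanLadder.UV` only.  Restate-immune (no Theses import).
-/

noncomputable section

namespace Summit.QuantumFields.YangMills.BalabanUVNodes.N15.Gluing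

open Real
open Literature.MathematicalPhysics.QuantumFieldTheory.Balaban1983to89
open Literature.MathematicalPhysics.QuantumFieldTheory.Balaban1983to89.B5Prop11Plancherel (Tor fine)
open Literature.MathematicalPhysics.QuantumFieldTheory.Balaban1983to89.B11SectG (BlockNorm HasMaj)
open Literature.MathematicalPhysics.QuantumFieldTheory.Balaban1983to89.T4EtaRateDefect (idef)
open Literature.MathematicalPhysics.QuantumFieldTheory.Balaban1983to89.T4EtaRateCoeffDefect (pull)
open Literature.MathematicalPhysics.QuantumFieldTheory.Balaban1983to89.B6Prop26Gluing (mulOp ind ind_nonneg ind_le_one)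
open Literature.MathematicalPhysics.QuantumFieldTheory.Balaban1983to89.B6UnitTorusCarrier (unitTorusGeo)
open Literature.MathematicalPhysics.QuantumFieldTheory.Balaban1983to89.B5SiteBridgeP12 (MP)
open Literature.MathematicalPhysics.QuantumFieldTheory.King1986.Torus (blockOf tdistT tdistT_nonneg)
open Summit.QuantumFields.YangMills.BalabanUVNodes.N15.VectorPiece (kingPrV blkFine)
open Summit.QuantumFields.YangMills.BalabanUVNodes.N15.TwoGrid (paramsOf deltaOp gOp)

variable {d : ℕ} {L : ℕ} [NeZero L]

/-! ## §1 The doubled-torus propagator pair `(Δ′_a⁻¹, Δ_a⁻¹)` -/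

section PairDoubled

/-- ★ **FILE 70 (iii) AT BOTH MEMBERS OF THE PAIR**: there is `w₀` (uniform) such that for `k ≥ 1`, `L^m ≥ w₀` the glued operator of the cover IS the torus propagator at the coarse
spacing `L^{−k}` AND at the fine spacing `L^{−(k+r)}` of the same torus: `G′_glued = Δ′_a⁻¹`, `G_glued = Δ_a⁻¹` — FILE 70 `knitGlued_spec` (iii) at the indices `k` and `r + k`, the
latter transported along `L^{r+k} = L^r·L^k` (the torus `MP (paramsOf d L (m+1) k hL)` does not depend on the spacing exponent). [cite: Balaban1984PropagatorsII, (2.91) p.239, p.247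
(«G = G₀(I − R)⁻¹»); Balaban1985BackgroundPropagators, Thm 3.1 p.397 («for M ≥ M₁»)] -/
theorem knitGlued_eq_gOp_fine (hL : Odd L ∧ 1 < L) {a : ℝ} (ha : 0 < a) :
    ∃ w₀ : ℝ, ∀ (m kk r : ℕ), 1 ≤ kk → w₀ ≤ ((L ^ m : ℕ) : ℝ) →
      knitGlued d L m kk (L ^ r * L ^ kk) hL a = gOp (MP (paramsOf d L (m + 1) kk hL)) (L ^ r * L ^ kk) a ∧
        knitGlued d L m kk (L ^ kk) hL a = gOp (MP (paramsOf d L (m + 1) kk hL)) (L ^ kk) a := by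
  obtain ⟨δ, w₀, B, -, -, H⟩ := knitGlued_spec (d := d) hL ha
  refine ⟨w₀, fun m kk r hk hw => ⟨?_, (H m kk hk hw).1.2.2⟩⟩
  have h3 : knitGlued d L m (r + kk) (L ^ (r + kk)) hL a = gOp (MP (paramsOf d L (m + 1) (r + kk) hL)) (L ^ (r + kk)) a := (H m (r + kk) (by omega) hw).1.2.2
  have gen : ∀ (n : ℕ) [NeZero n], n = L ^ (r + kk) → knitGlued d L m kk n hL a = gOp (MP (paramsOf d L (m + 1) kk hL)) n a := by
    intro n _ hn
    subst hn
    exact h3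
  exact gen (L ^ r * L ^ kk) (pow_add L r kk).symm

/-- ★★★ **THE TWO-GRID η-DEFECT OF THE TORUS PROPAGATOR PAIR `(Δ′_a⁻¹, Δ_a⁻¹)` AT `U ≡ 1` ON THE DOUBLED TORUS, ASSEMBLED FROM CUBE DATA, NO DISPLAYED ROW**: for odd `L ≥ 3`, `a > 0`
there are `δ, D > 0` and `w₀` (uniform in `m, k, r`) with `𝔇(Δ′_a⁻¹, Δ_a⁻¹) ≤ D·(L^k)^{−1∕16}·e^{−δ|y−y′|_T}` (King's pairing `P`, coarse unit blocks ∕ fine blocks through `P`) whenever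
`k ≥ 1`, `4 ≤ L^k`, `L^m ≥ w₀` — dag-n15-c FILE 80 `hasMaj_idef_knitGlued_closed` rewritten by FILE 70 (iii) at both members (★ `knitGlued_eq_gOp_fine`).  The entry-0 defect input of FILE 50's socket, row-free, on the doubled
torus. [cite: Balaban1984PropagatorsII, (2.36)–(2.37) p.229, (2.91)–(2.93) p.239, (2.133)–(2.136) p.247 (mechanism); Balaban1985BackgroundPropagators, Thm 3.1 p.397, Thm 3.14
pp.426–427 (difference template); Balaban1984PropagatorsI, Prop. 1.4 (1.121)–(1.123) p.37 (the printed torus statement this models at `U ≡ 1`)] -/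
theorem hasMaj_idef_gOp_pair_of_cubes (hL : Odd L ∧ 1 < L) {a : ℝ} (ha : 0 < a) :
    ∃ δ w₀ D : ℝ, 0 < δ ∧ 0 < D ∧ ∀ (m kk r : ℕ) (_hk : 1 ≤ kk) (_hn4 : 4 ≤ L ^ kk), w₀ ≤ ((L ^ m : ℕ) : ℝ) →
      HasMaj (BlockNorm.ofBlocks (unitTorusGeo L kk (MP (paramsOf d L (m + 1) kk hL)))
          (fun b : Tor (fine (L ^ kk) (MP (paramsOf d L (m + 1) kk hL))) × Fin (d + 1) => blockOf (L ^ kk) (MP (paramsOf d L (m + 1) kk hL)) b.1))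
        (BlockNorm.ofBlocks (unitTorusGeo L kk (MP (paramsOf d L (m + 1) kk hL)))
          (fun i : Tor (fine (L ^ r * L ^ kk) (MP (paramsOf d L (m + 1) kk hL))) × Fin (d + 1) => blockOf (L ^ r * L ^ kk) (MP (paramsOf d L (m + 1) kk hL)) i.1))
        (idef (pull (kingPrV L kk r (MP (paramsOf d L (m + 1) kk hL)))) (pull (kingPrV L kk r (MP (paramsOf d L (m + 1) kk hL))))
          (gOp (MP (paramsOf d L (m + 1) kk hL)) (L ^ r * L ^ kk) a) (gOp (MP (paramsOf d L (m + 1) kk hL)) (L ^ kk) a))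
        (fun y y' => D * ((L ^ kk : ℕ) : ℝ) ^ (-(1 / 16 : ℝ)) * Real.exp (-(δ * tdistT (MP (paramsOf d L (m + 1) kk hL)) y y'))) := by
  obtain ⟨δ, w₀, D, hδ, hD, H⟩ := hasMaj_idef_knitGlued_closed (d := d) hL ha
  obtain ⟨w₁, H1⟩ := knitGlued_eq_gOp_fine (d := d) hL ha
  refine ⟨δ, max w₀ w₁, D, hδ, hD, fun m kk r hk hn4 hw => ?_⟩
  have h := H m kk r hk hn4 ((le_max_left _ _).trans hw)
  obtain ⟨e', e⟩ := H1 m kk r hk ((le_max_right _ _).trans hw)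
  rw [e', e] at h
  exact h

end PairDoubled

/-! ## §2 The torus-of-record propagator pair `(Δ′_a⁻¹, Δ_a⁻¹)` -/

section PairRecord

/-- ★ **FILE 73 (iii) AT BOTH MEMBERS OF THE PAIR**: there is `w₀` (free of `m_T, s, K, r`) such that for `s + 1 ≤ m_T`, `K ≥ 1`, `L^s ≥ w₀` the glued operator of the cover IS the torus
propagator at the coarse spacing `L^{−K}` AND at the fine spacing `L^{−(K+r)}` of the same torus of record: `G′_{glued,R} = Δ′_a⁻¹`, `G_{glued,R} = Δ_a⁻¹` — FILE 73 `knitGluedR_spec` (iii)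
at the indices `K` and `r + K`, the latter transported along `L^{r+K} = L^r·L^K` (the torus `MP (paramsOf d L m_T K hL)` does not depend on the spacing exponent).
[cite: Balaban1984PropagatorsII, (2.91) p.239, p.247 («G = G₀(I − R)⁻¹»); Balaban1985BackgroundPropagators, Thm 3.1 p.397 («for M ≥ M₁»)] -/
theorem knitGluedR_eq_gOp_fine (hL : Odd L ∧ 1 < L) {a : ℝ} (ha : 0 < a) :
    ∃ w₀ : ℝ, ∀ (s mT K r : ℕ) (hs : s + 1 ≤ mT), 1 ≤ K → w₀ ≤ ((L ^ s : ℕ) : ℝ) →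
      knitGluedR d L s mT K (L ^ r * L ^ K) hL hs a = gOp (MP (paramsOf d L mT K hL)) (L ^ r * L ^ K) a ∧
        knitGluedR d L s mT K (L ^ K) hL hs a = gOp (MP (paramsOf d L mT K hL)) (L ^ K) a := by
  obtain ⟨δ, w₀, B, -, -, H⟩ := knitGluedR_spec (d := d) hL ha
  refine ⟨w₀, fun s mT K r hs hK hw => ⟨?_, (H s mT K hs hK hw).1.2.2⟩⟩
  have h3 : knitGluedR d L s mT (r + K) (L ^ (r + K)) hL hs a = gOp (MP (paramsOf d L mT (r + K) hL)) (L ^ (r + K)) a := (H s mT (r + K) hs (by omega) hw).1.2.2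
  have gen : ∀ (n : ℕ) [NeZero n], n = L ^ (r + K) → knitGluedR d L s mT K n hL hs a = gOp (MP (paramsOf d L mT K hL)) n a := by
    intro n _ hn
    subst hn
    exact h3
  exact gen (L ^ r * L ^ K) (pow_add L r K).symm

/-- ★★★ **THE TWO-GRID η-DEFECT OF THE TORUS-OF-RECORD PROPAGATOR PAIR `(Δ′_a⁻¹, Δ_a⁻¹)` AT `U ≡ 1`, ASSEMBLED FROM CUBE DATA OF FIXED SIZE, NO DISPLAYED ROW**: for odd `L ≥ 3`,
`a > 0` there are `δ, D > 0` and `w₀` FREE OF THE VOLUME `m_T`, the spacings `K, r` and the cube exponent `s` with `𝔇(Δ′_a⁻¹, Δ_a⁻¹) ≤ D·(L^K)^{−1∕16}·e^{−δ|y−y′|_T}` on `Tor(2L^{m_T})`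
(King's pairing `P`) whenever SOME cube exponent `s` has `s + 1 ≤ m_T` and `L^s ≥ w₀`, `K ≥ 1`, `4 ≤ L^K` — dag-n15-c FILE 82 `hasMaj_idef_knitGluedR` rewritten by FILE 73 (iii) at both members (★ `knitGluedR_eq_gOp_fine`).
The entry-0 defect input of FILE 50's socket, row-free, on the torus of record. [cite: Balaban1984PropagatorsII, (2.36)–(2.37) p.229, (2.91)–(2.93) p.239, (2.133)–(2.136) p.247
(mechanism); Balaban1985BackgroundPropagators, Thm 3.1 p.397, Thm 3.14 pp.426–427 (difference template); Balaban1984PropagatorsI, Prop. 1.4 (1.121)–(1.123) p.37 (the printed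
torus statement this models at `U ≡ 1`)] -/
theorem hasMaj_idef_gOp_pair_record (hL : Odd L ∧ 1 < L) {a : ℝ} (ha : 0 < a) :
    ∃ δ w₀ D : ℝ, 0 < δ ∧ 0 < D ∧ ∀ (s mT K r : ℕ) (_hs : s + 1 ≤ mT) (_hK : 1 ≤ K) (_hn4 : 4 ≤ L ^ K), w₀ ≤ ((L ^ s : ℕ) : ℝ) →
      HasMaj (BlockNorm.ofBlocks (unitTorusGeo L K (MP (paramsOf d L mT K hL))) (fun b : Tor (fine (L ^ K) (MP (paramsOf d L mT K hL))) × Fin (d + 1) => blockOf (L ^ K) (MP (paramsOf d L mT K hL)) b.1))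
        (BlockNorm.ofBlocks (unitTorusGeo L K (MP (paramsOf d L mT K hL)))
          (fun i : Tor (fine (L ^ r * L ^ K) (MP (paramsOf d L mT K hL))) × Fin (d + 1) => blockOf (L ^ r * L ^ K) (MP (paramsOf d L mT K hL)) i.1))
        (idef (pull (kingPrV L K r (MP (paramsOf d L mT K hL)))) (pull (kingPrV L K r (MP (paramsOf d L mT K hL))))
          (gOp (MP (paramsOf d L mT K hL)) (L ^ r * L ^ K) a) (gOp (MP (paramsOf d L mT K hL)) (L ^ K) a))
        (fun y y' => D * ((L ^ K : ℕ) : ℝ) ^ (-(1 / 16 : ℝ)) * Real.exp (-(δ * tdistT (MP (paramsOf d L mT K hL)) y y'))) := by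
  obtain ⟨δ, w₀, D, hδ, hD, H⟩ := hasMaj_idef_knitGluedR (d := d) hL ha
  obtain ⟨w₁, H1⟩ := knitGluedR_eq_gOp_fine (d := d) hL ha
  refine ⟨δ, max w₀ w₁, D, hδ, hD, fun s mT K r hs hK hn4 hw => ?_⟩
  have h := H s mT K r hs hK hn4 ((le_max_left _ _).trans hw)
  obtain ⟨e', e⟩ := H1 s mT K r hs hK ((le_max_right _ _).trans hw)
  rw [e', e] at h
  exact h

end PairRecord

end Summit.QuantumFields.YangMills.BalabanUVNodes.N15.Gluing

end
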